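import Summits.HodgeConjecture.HodgeConjecture.Theorems.Ring2AbelianAllAndreFibreGysinHodgeType
import HarnessLib

/-!
# Ring 2 · sub-cell AbelianAll (ALL ABELIAN VARIETIES), André axis, part XXIX-h — `j_{t*}` DETECTS RATIONALITY, HENCE HODGE
# CLASSES, ON THE INVARIANT PART; the Hodge classes of the total space divisible by the fibre class are algebraic, granted the
# lift and the Hodge conjecture of the fibre — unconditionally for `p ≤ 1` and for pencils of relative dimension `≤ 3`

HONEST FRAMING (page 1, verbatim): **research route, not a corollary; conditional on HC_CM plus one named
minimal statement.** Cell line: research route conditional on HC_CM; not a corollary; Q11.4-sentence-2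
already refuted in dim ≥ 3. Nothing in this file proves a case of the Hodge conjecture for an abelian variety. `HC_CM` =
`Theses.RankFourFaces.CMAbelianHodge` is a BINDER in the one row where it occurs (§3, last theorem); item
`Theses.RankFourFaces.CMToAbelian` (stmt-HodgeConjecture-16267) OPEN and not closed here. Seat `pub-hodge-ring2-ab-andre-2`, gen 21;
second half of owed item (o71) (RING2-MAP AA2.171/172), companion of part XXIX-g (`Ring2AbelianAllAndreFibreGysinHodgeType`).

## What is proved (theorems only; no definition, no named fact, no sorry)

§1 **`exists_isRationalClass_eq_of_isRationalClass_apply` — RATIONAL DESCENT OF RANGES for a rationality-preserving `ℂ`-linear map**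
`T : Hᵏ(X(ℂ); ℂ) → Hˡ(Y(ℂ); ℂ)`, `X` smooth projective: if `T x` is rational then `T x = T x₀` for a RATIONAL `x₀` (the tree's
`exists_isRationalClass_complexBetti_map_eq` is the case `T = φ^*`; here `T` need only map rational classes to rational classes —
its `ℚ`-form is built from the injectivity of `Hᵏ(–; ℚ) → Hᵏ(–; ℂ)` and the descent is `RationalClassesRingChange.ringChange_mem_span_image_iff`).
§2 (compact abelian pencils, `L_t = j_{t*} j_t^*`): **`isRationalClass_fiberGysin_map_fiberι_iff`** (`x ∪ [𝒳_t]` rational ⟺ `j_t^* x`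
rational), **`isHodgeClass_fiberGysin_map_fiberι_iff`** (with part XXIX-g: `x ∪ [𝒳_t]` is a Hodge class — rational of type `(p+1,p+1)` —
on `𝒳` iff `j_t^* x` is a Hodge class on `𝒳_t`): `j_{t*}` DETECTS HODGE CLASSES on the invariant part.
§3 **`fiberGysin_map_fiberι_mem_algebraicClasses_of_hodge_of_comap_le_sup`**: `HC^p(𝒳_t) ∧ (L)_t(p)` ⟹ every HODGE class of `𝒳`
of the form `x ∪ [𝒳_t]`, `x ∈ H^{2p}(𝒳(ℂ); ℂ)`, is ALGEBRAIC; unconditionally for `p ≤ 1` on every compact abelian pencil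
(`…_of_le_one`) and in every degree for pencils of relative dimension `d ≤ 3` (`…_of_relDim_le_three`: e.g. on the FOURFOLD total
space of a pencil of abelian threefolds every Hodge class divisible by the fibre class is algebraic); at CM fibres granted `HC_CM`
and the lift node (`…_of_HC_CM_of_cmFibreAlgebraicLift`). With (Div) (part XXIX-c) the two directions assemble: at a fibre
satisfying `HC^p`, [(L)_t(p)] ⟹ [Hodge classes `x ∪ [𝒳_t]` are algebraic] and [Div[t,p]] ⟹ [algebraic classes `x ∪ [𝒳_t]` are
`[𝒳_t]`-multiples of algebraic classes].

## Honest status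

Nothing here is progress on `HC_AV`; the unconditional statements of §3 are small cases of the Hodge conjecture for the
`(d+1)`-fold total spaces (classes divisible by the fibre class, in the degrees where the lift is a theorem) — for `p ≤ 1` they
amount to "a Hodge class `x ∪ [𝒳_t]` with `x` of degree `2` is `D ∪ [𝒳_t]` for a divisor class `D`" (Lefschetz (1,1) on the
fibre and on the total space with Deligne's semisimplicity), recorded as theorems of the tree, not as claims of novelty; no node
is born; nothing is minimal.

References: VoisinHodgeI2002 (§7.1.1, §7.3.2, Thm. 11.30); HatcherAT2002 (§3.1 Thm. 3.2); DeligneHodgeII1971 (Thm. 4.1.1);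
Andre1996Motifs (§5.1, Lemme 6.3.1); Milne2020HodgeClassesAV (Prop. 1); Lieberman1968 (Thm. 1).
-/

noncomputable section

set_option linter.dupNamespace false

namespace Summit.HodgeConjecture.HodgeConjecture.Ring2.AbelianAll

open CategoryTheory AlgebraicGeometry
open Literature.AlgebraicGeometry Literature.AlgebraicGeometry.Motives
open Literature.AlgebraicGeometry.HodgeTheory
open Literature.AlgebraicTopology.SingularHomology (singularCohomology singularHomology)
open Literature.AlgebraicGeometry.Deligne1982 (cmLocus)
open Summit.HodgeConjecture.HodgeConjecture
open Summit.HodgeConjecture.HodgeConjecture.Theses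

/-! ## §1 Rational descent of ranges for a rationality-preserving linear map -/

section Descent

variable {n k l : ℕ} {X Y : SchemeOver ℂ}

/-- **Rational descent of ranges.** Let `X` be smooth projective (so that `Hᵏ(X(ℂ); ℚ)` is finite-dimensional and the rational
classes span `Hᵏ(X(ℂ); ℂ)`), and `T : Hᵏ(X(ℂ); ℂ) → Hˡ(Y(ℂ); ℂ)` a `ℂ`-linear map taking rational classes to rational classes. If
`T x` is rational, then `T x = T x₀` for some RATIONAL `x₀`. Proof: `T` has a `ℚ`-form `G` (`ι ∘ G = T ∘ ι`, `ι = Hᵏ(–;ℚ) → Hᵏ(–;ℂ)`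
injective), `T x ∈ ℂ · ι(range G)`, and a rational class in the `ℂ`-span of `ι(V)` lies in `ι(V)` (Voisin I §7.1.1,
`ringChange_mem_span_image_iff`). [cite: VoisinHodgeI2002, §7.1.1] [cite: HatcherAT2002, §3.1 Thm. 3.2 and p. 198] -/
theorem exists_isRationalClass_eq_of_isRationalClass_apply (hX : IsSmoothProjective n X)
    (T : complexBetti X k →ₗ[ℂ] complexBetti Y l) (hT : ∀ c, IsRationalClass c → IsRationalClass (T c))
    {x : complexBetti X k} (hx : IsRationalClass (T x)) :
    ∃ x₀ : complexBetti X k, IsRationalClass x₀ ∧ T x₀ = T x := by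
  haveI := finite_singularHomology_rat_complexPoints hX k
  set ιX := singularCohomology.ringChange (algebraMap ℚ ℂ) (ComplexPoints X) k with hιX
  set ιY := singularCohomology.ringChange (algebraMap ℚ ℂ) (ComplexPoints Y) l with hιY
  -- the ℚ-form of `T`
  have hex : ∀ a : singularCohomology ℚ ℚ (ComplexPoints X) k,
      ∃ b : singularCohomology ℚ ℚ (ComplexPoints Y) l, ιY b = T (ιX a) :=
    fun a ↦ (hT _ (isRationalClass_ringChange a)).exists_ringChange_eq
  choose g hg using hex
  let G : singularCohomology ℚ ℚ (ComplexPoints X) k →ₗ[ℚ] singularCohomology ℚ ℚ (ComplexPoints Y) l :=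
    { toFun := g
      map_add' := fun a b ↦ ringChange_rat_injective (by
        change ιY (g (a + b)) = ιY (g a + g b)
        rw [hg, map_add, map_add, map_add, hg, hg])
      map_smul' := fun q a ↦ ringChange_rat_injective (by
        change ιY (g (q • a)) = ιY (q • g a)
        rw [hg, ringChange_ratCast_smul, ringChange_ratCast_smul, map_smul, hg]) }
  have hG : ∀ a, ιY (G a) = T (ιX a) := hg
  set V : Submodule ℚ (singularCohomology ℚ ℚ (ComplexPoints Y) l) := LinearMap.range G with hV
  obtain ⟨a₀, ha₀⟩ := hx.exists_ringChange_eq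
  -- `T` maps every rational class, hence everything, into `ℂ · ι(V)`
  have hle : Submodule.span ℂ {c : complexBetti X k | IsRationalClass c} ≤
      (Submodule.span ℂ (ιY '' (V : Set (singularCohomology ℚ ℚ (ComplexPoints Y) l)))).comap T := by
    rw [Submodule.span_le]
    intro c hc
    obtain ⟨a, rfl⟩ := IsRationalClass.exists_ringChange_eq hc
    change T (ιX a) ∈ Submodule.span ℂ (ιY '' (V : Set (singularCohomology ℚ ℚ (ComplexPoints Y) l)))
    rw [← hG]
    exact Submodule.subset_span ⟨G a, LinearMap.mem_range_self G a, rfl⟩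
  have hspan : ιY a₀ ∈ Submodule.span ℂ (ιY '' (V : Set (singularCohomology ℚ ℚ (ComplexPoints Y) l))) := by
    rw [ha₀]
    exact hle (by rw [span_isRationalClass_eq_top k]; exact Submodule.mem_top)
  obtain ⟨a', ha'⟩ : a₀ ∈ V := (ringChange_mem_span_image_iff V a₀).1 hspan
  refine ⟨ιX a', isRationalClass_ringChange a', ?_⟩
  rw [← hG, ha', ha₀]

end Descent

/-! ## §2 Compact abelian pencils: `j_{t*}` detects rationality and Hodge classes on the invariant part -/

section Pencil

variable {𝒳 S : SchemeOver ℂ} {d : ℕ} {f : 𝒳 ⟶ S}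

/-- **If `x ∪ [𝒳_t]` is rational then `j_t^* x = j_t^* x₀` for a RATIONAL `x₀`** (§1 for `T = L_t`, which preserves rationality,
part X-b; then Deligne's kernel identity κ_f). [cite: VoisinHodgeI2002, §7.1.1 and §7.3.2] [cite: DeligneHodgeII1971, Thm. 4.1.1] -/
theorem exists_isRationalClass_map_fiberι_eq_of_fiberGysin (hf : IsCompactAbelianPencil f d) (t : ComplexPoints S) {p : ℕ}
    {x : complexBetti 𝒳 (2 * p)} (hx : IsRationalClass (fiberGysin hf t p (complexBetti.map (fiberι f t) (2 * p) x))) :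
    ∃ x₀ : complexBetti 𝒳 (2 * p), IsRationalClass x₀ ∧
      complexBetti.map (fiberι f t) (2 * p) x₀ = complexBetti.map (fiberι f t) (2 * p) x := by
  obtain ⟨x₀, hx₀, hL⟩ := exists_isRationalClass_eq_of_isRationalClass_apply hf.isSmoothProjective_total
    ((fiberGysin hf t p) ∘ₗ (complexBetti.map (fiberι f t) (2 * p)).hom)
    (fun c hc ↦ isRationalClass_fiberGysin_map_fiberι hf t hc) (x := x) hx
  refine ⟨x₀, hx₀, ?_⟩
  have h0 : fiberGysin hf t p (complexBetti.map (fiberι f t) (2 * p) (x₀ - x)) = 0 := by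
    rw [map_sub, map_sub, sub_eq_zero]
    exact hL
  have hk := fibreGysinKernelOn_holds hf p t t (x₀ - x) h0
  rwa [map_sub, sub_eq_zero] at hk

/-- **`j_{t*}` DETECTS RATIONALITY on the invariant part: `x ∪ [𝒳_t]` is rational iff `j_t^* x` is rational.**
[cite: VoisinHodgeI2002, §7.1.1 and §7.3.2] -/
theorem isRationalClass_fiberGysin_map_fiberι_iff (hf : IsCompactAbelianPencil f d) (t : ComplexPoints S) {p : ℕ}
    (x : complexBetti 𝒳 (2 * p)) :
    IsRationalClass (fiberGysin hf t p (complexBetti.map (fiberι f t) (2 * p) x)) ↔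
      IsRationalClass (complexBetti.map (fiberι f t) (2 * p) x) := by
  refine ⟨fun h ↦ ?_, fun h ↦ ?_⟩
  · obtain ⟨x₀, hx₀, hx₀x⟩ := exists_isRationalClass_map_fiberι_eq_of_fiberGysin hf t h
    rw [← hx₀x]
    exact hx₀.map (AlgPoints.mapContinuous (L := ℂ) (fiberι f t))
  · exact isRationalClass_complexGysin_complexOrientationFamily (hf.isSmoothProjective_fiberOver t)
      hf.isSmoothProjective_total (fiberι f t) _ h

/-- **`j_{t*}` DETECTS HODGE CLASSES on the invariant part: `x ∪ [𝒳_t]` is a Hodge class of `𝒳` (rational, of type `(p+1,p+1)`)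
iff `j_t^* x` is a Hodge class of `𝒳_t` (rational, of type `(p,p)`).** (Rationality: this part; type: part XXIX-g.)
[cite: VoisinHodgeI2002, §7.1.1, §7.3.2 and §11.3 Prop. 11.20] [cite: DeligneHodgeII1971, Thm. 4.1.1] -/
theorem isHodgeClass_fiberGysin_map_fiberι_iff (hf : IsCompactAbelianPencil f d) (t : ComplexPoints S) {p : ℕ}
    (x : complexBetti 𝒳 (2 * p)) :
    (IsRationalClass (fiberGysin hf t p (complexBetti.map (fiberι f t) (2 * p) x)) ∧
        IsOfHodgeType (d + 1) 𝒳 (2 * (p + 1)) (p + 1) (p + 1) (fiberGysin hf t p (complexBetti.map (fiberι f t) (2 * p) x))) ↔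
      (IsRationalClass (complexBetti.map (fiberι f t) (2 * p) x) ∧
        IsOfHodgeType d (fiberOver f t) (2 * p) p p (complexBetti.map (fiberι f t) (2 * p) x)) :=
  and_congr (isRationalClass_fiberGysin_map_fiberι_iff hf t x)
    (isOfHodgeType_fiberGysin_map_fiberι_iff hf t (show p + p = 2 * p by ring) x)

/-! ## §3 The Hodge classes of the total space divisible by the fibre class are algebraic, granted the lift and `HC^p` of the fibre -/

/-- **`HC^p(𝒳_t) ∧ (L)_t(p) ⟹ every Hodge class `x ∪ [𝒳_t]` of `𝒳` is algebraic** (`x ∈ H^{2p}(𝒳(ℂ); ℂ)`): `j_t^* x` is a Hodge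
class of the fibre (§2), hence algebraic (`HC^p(𝒳_t)`), so `x ∈ N^p(𝒳) + ker j_t^*` ((L)_t(p)) and `x ∪ [𝒳_t] ∈ [𝒳_t] · N^p(𝒳) ⊆
N^{p+1}(𝒳)`. [cite: Milne2020HodgeClassesAV, Prop. 1 (p. 7)] [cite: VoisinHodgeI2002, §11.3 and §7.3.2] -/
theorem fiberGysin_map_fiberι_mem_algebraicClasses_of_hodge_of_comap_le_sup (hf : IsCompactAbelianPencil f d)
    (t : ComplexPoints S) {p : ℕ}
    (hp : ∀ c : complexBetti (fiberOver f t) (2 * p), IsRationalClass c →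
      IsOfHodgeType d (fiberOver f t) (2 * p) p p c → c ∈ algebraicClasses (fiberOver f t) p)
    (hL : (algebraicClasses (fiberOver f t) p).comap (complexBetti.map (fiberι f t) (2 * p)).hom ≤
      algebraicClasses 𝒳 p ⊔ LinearMap.ker (complexBetti.map (fiberι f t) (2 * p)).hom)
    {x : complexBetti 𝒳 (2 * p)} (hxQ : IsRationalClass (fiberGysin hf t p (complexBetti.map (fiberι f t) (2 * p) x)))
    (hxH : IsOfHodgeType (d + 1) 𝒳 (2 * (p + 1)) (p + 1) (p + 1) (fiberGysin hf t p (complexBetti.map (fiberι f t) (2 * p) x))) :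
    fiberGysin hf t p (complexBetti.map (fiberι f t) (2 * p) x) ∈ algebraicClasses 𝒳 (p + 1) := by
  obtain ⟨hQ, hH⟩ := (isHodgeClass_fiberGysin_map_fiberι_iff hf t x).1 ⟨hxQ, hxH⟩
  have halg : complexBetti.map (fiberι f t) (2 * p) x ∈ algebraicClasses (fiberOver f t) p := hp _ hQ hH
  obtain ⟨a, ha, k, hk, hak⟩ := Submodule.mem_sup.1 (hL halg)
  have hk' : complexBetti.map (fiberι f t) (2 * p) k = 0 := LinearMap.mem_ker.1 hk
  rw [← hak, map_add, map_add, hk', map_zero, add_zero]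
  exact fiberGysin_mem_algebraicClasses hf t (algebraicClasses_sup_ker_le_comap hf p t (Submodule.mem_sup_left ha))

/-- **Unconditionally for `p ≤ 1` on every compact abelian pencil: a Hodge class `x ∪ [𝒳_t]` with `x` of degree `0` or `2` is
algebraic** (Lefschetz (1,1) on the fibre; the lift in degree `≤ 2`, part XVIII-f). [cite: VoisinHodgeI2002, Thm. 11.30]
[cite: Lieberman1968, Thm. 1] -/
theorem fiberGysin_map_fiberι_mem_algebraicClasses_of_hodge_of_le_one (hf : IsCompactAbelianPencil f d) (t : ComplexPoints S)
    {p : ℕ} (hp1 : p ≤ 1) {x : complexBetti 𝒳 (2 * p)}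
    (hxQ : IsRationalClass (fiberGysin hf t p (complexBetti.map (fiberι f t) (2 * p) x)))
    (hxH : IsOfHodgeType (d + 1) 𝒳 (2 * (p + 1)) (p + 1) (p + 1) (fiberGysin hf t p (complexBetti.map (fiberι f t) (2 * p) x))) :
    fiberGysin hf t p (complexBetti.map (fiberι f t) (2 * p) x) ∈ algebraicClasses 𝒳 (p + 1) := by
  rcases Nat.lt_or_ge d p with hdp | hdp
  · haveI := subsingleton_complexBetti (hf.isSmoothProjective_fiberOver t) (show 2 * d < 2 * p by omega)
    rw [Subsingleton.elim (complexBetti.map (fiberι f t) (2 * p) x) 0, map_zero]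
    exact Submodule.zero_mem _
  · refine fiberGysin_map_fiberι_mem_algebraicClasses_of_hodge_of_comap_le_sup hf t (fun c hcQ hcH ↦ ?_)
      (comap_le_sup_of_extreme hf t (show p + (d - p) = d by omega) (Or.inl hp1)) hxQ hxH
    rcases Nat.le_one_iff_eq_zero_or_eq_one.1 hp1 with rfl | rfl
    · rw [algebraicClasses_zero]
      exact Submodule.mem_top
    · exact lefschetzOneOne_rational_holds (hf.isSmoothProjective_fiberOver t) c hcQ hcH

/-- **Unconditionally in EVERY degree for compact pencils of abelian curves, surfaces or threefolds** (`d ≤ 3`): on the total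
space (of dimension `≤ 4`) every Hodge class divisible by the fibre class is algebraic (the Hodge conjecture for the fibre, of
dimension `≤ 3`, and the lift in every degree, part XVIII-f, are tree theorems). [cite: VoisinHodgeII2003, §10.2.3 proof of Prop. 10.26]
[cite: Lieberman1968, Thm. 1] -/
theorem fiberGysin_map_fiberι_mem_algebraicClasses_of_hodge_of_relDim_le_three (hf : IsCompactAbelianPencil f d) (hd : d ≤ 3)
    (t : ComplexPoints S) {p : ℕ} {x : complexBetti 𝒳 (2 * p)}
    (hxQ : IsRationalClass (fiberGysin hf t p (complexBetti.map (fiberι f t) (2 * p) x)))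
    (hxH : IsOfHodgeType (d + 1) 𝒳 (2 * (p + 1)) (p + 1) (p + 1) (fiberGysin hf t p (complexBetti.map (fiberι f t) (2 * p) x))) :
    fiberGysin hf t p (complexBetti.map (fiberι f t) (2 * p) x) ∈ algebraicClasses 𝒳 (p + 1) :=
  fiberGysin_map_fiberι_mem_algebraicClasses_of_hodge_of_comap_le_sup hf t
    (fun c hcQ hcH ↦ hodgeClasses_algebraic_of_dim_le_three_holds hd (hf.isSmoothProjective_fiberOver t) p c hcQ hcH)
    (comap_le_sup_of_relDim_le_three hd hf t p) hxQ hxH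

/-- **At a CM fibre, granted `HC_CM` (BINDER) and the lift node `CMFibreAlgebraicLift`: every Hodge class `x ∪ [𝒳_t]` of the total
space is algebraic** — a consequence, for the NON-abelian `(d+1)`-folds `𝒳`, of the André-axis hypotheses.
[cite: Andre1996Motifs, Lemme 6.3.1 (p. 31)] [cite: Milne2020HodgeClassesAV, Prop. 1 (p. 7)] -/
theorem fiberGysin_map_fiberι_mem_algebraicClasses_of_hodge_of_HC_CM_of_cmFibreAlgebraicLift (hCM : RankFourFaces.CMAbelianHodge)
    (hLift : CMFibreAlgebraicLift) (hf : IsCompactAbelianPencil f d) {t : ComplexPoints S} (ht : t ∈ cmLocus f d) {p : ℕ}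
    {x : complexBetti 𝒳 (2 * p)} (hxQ : IsRationalClass (fiberGysin hf t p (complexBetti.map (fiberι f t) (2 * p) x)))
    (hxH : IsOfHodgeType (d + 1) 𝒳 (2 * (p + 1)) (p + 1) (p + 1) (fiberGysin hf t p (complexBetti.map (fiberι f t) (2 * p) x))) :
    fiberGysin hf t p (complexBetti.map (fiberι f t) (2 * p) x) ∈ algebraicClasses 𝒳 (p + 1) := by
  obtain ⟨A₀, ⟨e₀⟩, hdim, hcm⟩ := ht
  exact fiberGysin_map_fiberι_mem_algebraicClasses_of_hodge_of_comap_le_sup hf t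
    (fun c hc hcpp ↦ Ring2Transport.mem_algebraicClasses_of_cmChart hCM A₀ e₀ hdim hcm hc hcpp)
    (cmFibreAlgebraicLift_iff_comap_le_sup.1 hLift f hf p t ⟨A₀, ⟨e₀⟩, hdim, hcm⟩) hxQ hxH

end Pencil

end Summit.HodgeConjecture.HodgeConjecture.Ring2.AbelianAll

end
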